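import Literature.MathematicalPhysics.QuantumFieldTheory.Balaban1983to89.B9SmoothHolderClassPI
import Literature.MathematicalPhysics.QuantumFieldTheory.Balaban1983to89.B9GradViaDivLettersAtPins

/-!
# `Balaban1983to89.B9GradLetterTransportedDict` — T. Bałaban, *Propagators for lattice gauge theories in a background field*, Commun. Math. Phys. **99** (1985) 389–434
# [Balaban1985BackgroundPropagators], (3.3) p. 391 + (3.40) p. 397: THE DICTIONARY OF THE LETTER `J_μ` BETWEEN THE TRANSPORTED INPUT CLASSES — its assembled bond values
# (`−R(U_μ(x))·(the slice at x + e_μ)`), its transported pair term at an admissible bond pair (`−R(U_μ(x))·[X⁺ − R(U_μ(x)⁻¹U(Γ_{x,x′})U_μ(x′))X′⁺]`), the reduction of the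
# transporter discrepancy to the LADDER (`‖U(Γ⁺) − U_μ(x)⁻¹U(Γ)U_μ(x′)‖ ≤ ‖ladder − 1‖`), and the lattice bookkeeping of the shift (`|x+e_κ − z+e_κ|_∞ = |x − z|_∞`, `|x − (x+e_κ)|_∞ ≤ 1`)

[4] = T. Bałaban, *Propagators and renormalization transformations for lattice gauge theories. II*, Commun. Math. Phys. **96** (1984) 223–250 [`Balaban1984PropagatorsII`].
statement-level skeleton of published theorems with citation tags; proofs where landed; nothing here is a claim about the Yang–Mills mass gap.

THE PRINT.  (3.3) p. 391 (*"A_μ(x) = A(x, x + ηe_μ)"*, the covariant gradient D_U, its letter `J_μ`: def-Y `Jb U μ Φ ⟨x,μ⟩ = −R(U_μ(x)) Φ(x + e_μ)`, `B9GradViaDivLettersAtPins` :80);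
(3.40) p. 397 (the transported Hölder quotient along *"a shortest contour"*); [4] (2.137) p. 247 (admissible pairs).

WHY THIS FILE (cell `pub-ymgap`, node N06 [B9], seat `pub-ymgap-dag-n06-c` g21; `LOCATED22-ADOPTION-MEMO-g21.md` §3.3 (a), sibling `B9GradLetterLadderHolonomy` = D1a).  The
class letter `J_μ : bHZP (taxiS U) s → bHZKP (taxiB U) s` (D1b, the twin of this lineage's B1 `B9SmoothHolderClassSliceSN.hasMaj_dirSliceK_bHZKP_bHZP` in the other direction, WITH
the link factor) needs a small dictionary, typed here once: §1 `norm_le_basisBound39_of_repr_le` (an `𝔸`-value from its coordinates), ★ `norm_R_sub_R_le` (two transporters: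
`‖R(g₁)X − R(g₂)X‖ ≤ 2‖g₁ − g₂‖‖X‖`, dag-n06-c g19's private lemma made public), ★ `norm_sub_conj_le_ladder` (`‖g⁺ − u⁻¹gu′‖ ≤ ‖g·u′·g⁺⁻¹·u⁻¹ − 1‖` for unitary-like units);
§2 `supDist_shift_shift`, `supDist_self_shift_le_one`, `nearS_chartY_shift`, `levY_chartY_shift_window` (the shifted site is a near site: levels differ by ≤ 1); §3 ★
`assembleK_JcoKH` (the assembled bond value of `J_μλ`), `JcoKH_apply_of_ne` (zero off the direction `μ`), ★ `abs_JcoKH_apply_le`, ★★ `jb_pair_identity` (the algebra of the pair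
term: `−R(u)X⁺ − R(g)(−R(u′)X′⁺) = −R(u)(X⁺ − R(u⁻¹gu′)X′⁺)`), ★★ `trDif_JcoKH` (the transported pair term of `J_μλ` at a same-direction bond pair).

HONEST SCOPE.  Finite-dimensional letter algebra and lattice bookkeeping; nothing of [B9] asserted; COUNT-NEUTRAL; N06 NOT discharged; nothing continuum, nothing about the mass gap.
A NEW file; 0 `def`, no `sorry`, no `axiom`, no `instance`, no `notation`.
-/

noncomputable section

namespace Literature.MathematicalPhysics.QuantumFieldTheory.Balaban1983to89.B9GradLetterTransportedDict

open T4RelativeLadder (UnitaryLike norm_unit_mul_le norm_mul_unit_le)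
open B4TorusKernel.MultiPeriod (torusSupNorm torusSupNorm_nonneg)
open B6GlobalChartV1 (PV blkV1 boxEquiv)
open B6Geom246MultiLevelTorus (geomT torusSupNorm_neg)
open B6Ineq2142KLevelV1 (β lvl shift_apply_of_ne)
open B6KLevelCensusIndexV1 (KIdx Adm)
open B6MultiLevelTorusOperator (one_le_of_mem)
open B9Eq39Adjoint (R R_def R_add R_sub R_neg R_mul)
open B9Thm39ReadingCoords (coordBound39 basisBound39 abs_repr_le)
open B9CoReadingCoords (assembleK XBK)
open B9CoReadingCoordsS (XSK)
open B9CoReadingCoordsH (assembleK_coordOpKH)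
open B9CoReadingCoordsHolderSNear (NearS)
open B9SmoothHolderClassT (trDif trDif_apply)
open B9SmoothHolderClassSliceSNDict (levY_window_of_nearS)
open B9GradViaDivLettersTransported (taxiS taxiB)
open B9GradViaDivLettersAtPins (Jb Jb_apply JcoKH JcoKH_apply)
open B9Eq340ProbeBridgeSNtoKA (supDist_eq_torusSupNorm)
open B9Eq340TaxiTelescope (norm_R_le)
open Node00 (SiteY FBondY IBondY CfgY toKT levY parTaxiV)
open Node00.OpsYNablaBridge (chartY)
open LatticeFieldCalculus (supDist)

variable {d ℓ : ℕ} {hd : 1 ≤ d + 1} {hL : Odd (ℓ + 1) ∧ 1 < ℓ + 1} {b₀ b₁ : ℝ}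
variable {𝔸 : Type} [NormedRing 𝔸] [NormedAlgebra ℂ 𝔸] [CompleteSpace 𝔸]
variable {κ : Type} [Fintype κ]

/-! ## §1 Algebra: coordinates, two transporters, the ladder -/

section Algebra

omit [CompleteSpace 𝔸] in
/-- an `𝔸`-value is at most `b_b := Σ_a ‖b_a‖` times the size of its coordinates. [cite: Balaban1985BackgroundPropagators, (3.39) p.397 (coordinates), bookkeeping] -/
theorem norm_le_basisBound39_of_repr_le (b : Module.Basis κ ℝ 𝔸) (v : 𝔸) {M : ℝ} (hM : ∀ a : κ, |b.repr v a| ≤ M) : ‖v‖ ≤ basisBound39 b * M := by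
  conv_lhs => rw [← b.sum_repr v]
  calc ‖∑ a, b.repr v a • b a‖ ≤ ∑ a, ‖b.repr v a • b a‖ := norm_sum_le _ _
    _ = ∑ a, |b.repr v a| * ‖b a‖ := by simp [norm_smul]
    _ ≤ ∑ a, M * ‖b a‖ := Finset.sum_le_sum fun a _ => mul_le_mul_of_nonneg_right (hM a) (norm_nonneg _)
    _ = basisBound39 b * M := by rw [← Finset.mul_sum, basisBound39, mul_comm]

omit [NormedAlgebra ℂ 𝔸] [CompleteSpace 𝔸] in
/-- ★ **TWO TRANSPORTERS**: for unitary-like `g₁, g₂`, `‖R(g₁)X − R(g₂)X‖ ≤ 2‖g₁ − g₂‖·‖X‖` (dag-n06-c g19's private `B9Eq340ProbeTransferSNY.norm_R_sub_R_le'`, public).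
[cite: Balaban1985BackgroundPropagators, (3.40) p.397, bookkeeping] -/
theorem norm_R_sub_R_le [NormOneClass 𝔸] {g₁ g₂ : 𝔸ˣ} (h₁ : UnitaryLike g₁) (h₂ : UnitaryLike g₂) (X : 𝔸) :
    ‖R g₁ X - R g₂ X‖ ≤ 2 * ‖(g₁ : 𝔸) - g₂‖ * ‖X‖ := by
  have hinv : ((g₁⁻¹ : 𝔸ˣ) : 𝔸) - ((g₂⁻¹ : 𝔸ˣ) : 𝔸) = ((g₁⁻¹ : 𝔸ˣ) : 𝔸) * ((g₂ : 𝔸) - g₁) * ((g₂⁻¹ : 𝔸ˣ) : 𝔸) := by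
    rw [mul_sub, sub_mul, Units.mul_inv_cancel_right, Units.inv_mul, one_mul]
  have hinvn : ‖((g₁⁻¹ : 𝔸ˣ) : 𝔸) - ((g₂⁻¹ : 𝔸ˣ) : 𝔸)‖ ≤ ‖(g₁ : 𝔸) - g₂‖ := by
    rw [hinv]
    calc _ ≤ ‖((g₁⁻¹ : 𝔸ˣ) : 𝔸) * ((g₂ : 𝔸) - g₁)‖ := norm_mul_unit_le h₂.inv _
      _ ≤ ‖(g₂ : 𝔸) - g₁‖ := norm_unit_mul_le h₁.inv _
      _ = ‖(g₁ : 𝔸) - g₂‖ := norm_sub_rev _ _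
  have hsplit : R g₁ X - R g₂ X = ((g₁ : 𝔸) - g₂) * X * ((g₁⁻¹ : 𝔸ˣ) : 𝔸) + (g₂ : 𝔸) * X * (((g₁⁻¹ : 𝔸ˣ) : 𝔸) - ((g₂⁻¹ : 𝔸ˣ) : 𝔸)) := by
    simp only [R]; noncomm_ring
  rw [hsplit]
  calc _ ≤ ‖((g₁ : 𝔸) - g₂) * X * ((g₁⁻¹ : 𝔸ˣ) : 𝔸)‖ + ‖(g₂ : 𝔸) * X * (((g₁⁻¹ : 𝔸ˣ) : 𝔸) - ((g₂⁻¹ : 𝔸ˣ) : 𝔸))‖ := norm_add_le _ _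
    _ ≤ ‖(g₁ : 𝔸) - g₂‖ * ‖X‖ + ‖X‖ * ‖(g₁ : 𝔸) - g₂‖ := by
        refine add_le_add ?_ ?_
        · exact (norm_mul_unit_le h₁.inv _).trans (norm_mul_le _ _)
        · rw [mul_assoc]
          exact (norm_unit_mul_le h₂ _).trans ((norm_mul_le _ _).trans (mul_le_mul_of_nonneg_left hinvn (norm_nonneg _)))
    _ = 2 * ‖(g₁ : 𝔸) - g₂‖ * ‖X‖ := by ring

omit [NormedAlgebra ℂ 𝔸] [CompleteSpace 𝔸] in
/-- ★ **THE TRANSPORTER DISCREPANCY IS THE LADDER DEFECT**: `g⁺ − u⁻¹·g·u′ = u⁻¹·(1 − L)·(u·g⁺)` with the ladder `L = g·u′·g⁺⁻¹·u⁻¹`, so for unitary-like `u, g⁺`: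
`‖g⁺ − u⁻¹gu′‖ ≤ ‖L − 1‖` (`g = U(Γ_{x,x′})`, `g⁺ = U(Γ_{x+e_μ,x′+e_μ})`, `u, u′` the two μ-links). [cite: Balaban1985BackgroundPropagators, (3.40) p.397 + (3.3) p.391, bookkeeping] -/
theorem norm_sub_conj_le_ladder [NormOneClass 𝔸] {u u' g gp : 𝔸ˣ} (hu : UnitaryLike u) (hgp : UnitaryLike gp) :
    ‖(gp : 𝔸) - ((u⁻¹ * g * u' : 𝔸ˣ) : 𝔸)‖ ≤ ‖((g * u' * gp⁻¹ * u⁻¹ : 𝔸ˣ) : 𝔸) - 1‖ := by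
  have hL : ((g * u' * gp⁻¹ * u⁻¹ : 𝔸ˣ) : 𝔸) * ((u : 𝔸) * gp) = (g : 𝔸) * u' := by
    rw [← Units.val_mul, ← Units.val_mul, ← Units.val_mul]
    congr 1
    group
  have key : (gp : 𝔸) - ((u⁻¹ * g * u' : 𝔸ˣ) : 𝔸) = ((u⁻¹ : 𝔸ˣ) : 𝔸) * ((1 - ((g * u' * gp⁻¹ * u⁻¹ : 𝔸ˣ) : 𝔸)) * ((u : 𝔸) * gp)) := by
    rw [sub_mul, one_mul, hL, mul_sub, ← mul_assoc, ← mul_assoc, Units.inv_mul, one_mul, Units.val_mul, Units.val_mul, mul_assoc]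
  rw [key]
  have hugp : UnitaryLike (u * gp) := hu.mul hgp
  calc ‖((u⁻¹ : 𝔸ˣ) : 𝔸) * ((1 - ((g * u' * gp⁻¹ * u⁻¹ : 𝔸ˣ) : 𝔸)) * ((u : 𝔸) * gp))‖
      ≤ ‖(1 - ((g * u' * gp⁻¹ * u⁻¹ : 𝔸ˣ) : 𝔸)) * ((u : 𝔸) * gp)‖ := norm_unit_mul_le hu.inv _
    _ = ‖(1 - ((g * u' * gp⁻¹ * u⁻¹ : 𝔸ˣ) : 𝔸)) * ((u * gp : 𝔸ˣ) : 𝔸)‖ := by rw [Units.val_mul u gp]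
    _ ≤ ‖1 - ((g * u' * gp⁻¹ * u⁻¹ : 𝔸ˣ) : 𝔸)‖ := norm_mul_unit_le hugp _
    _ = _ := norm_sub_rev _ _

end Algebra

/-! ## §2 Lattice bookkeeping of the shift -/

section Lattice

variable (i : KIdx d ℓ hd hL b₀ b₁)

omit [Fintype κ] in
/-- the translated label in the translation direction: `(x + e_μ)_μ = x_μ + 1`. [cite: Balaban1985BackgroundPropagators, (3.1) p.390, dictionary] -/
theorem shift_apply_self' {P : Params} (x : Site P 0) (μ : Fin P.d) : (x.shift μ) μ = x μ + 1 := by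
  simp only [Site.shift, Function.update_self]

omit [Fintype κ] in
/-- `|x+e_κ − (z+e_κ)|_∞ = |x − z|_∞`: translating a pair does not change its distance. [cite: Balaban1984PropagatorsII, (2.1) p.224, bookkeeping] -/
theorem supDist_shift_shift {P : Params} (x z : Site P 0) (κ' : Fin P.d) : supDist (x.shift κ') (z.shift κ') = supDist x z := by
  unfold supDist
  congr 1
  funext μ
  by_cases h : μ = κ'
  · subst h
    rw [shift_apply_self', shift_apply_self', add_sub_add_right_eq_sub, add_sub_add_right_eq_sub]
  · rw [shift_apply_of_ne x h, shift_apply_of_ne z h]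

omit [Fintype κ] in
/-- `|x − (x+e_κ)|_∞ ≤ 1`: a site and its neighbour. [cite: Balaban1984PropagatorsII, (2.1) p.224, bookkeeping] -/
theorem supDist_self_shift_le_one {P : Params} (x : Site P 0) (κ' : Fin P.d) : supDist x (x.shift κ') ≤ 1 := by
  unfold supDist
  refine Finset.sup_le fun μ _ => ?_
  by_cases h : μ = κ'
  · subst h
    rw [shift_apply_self', show x μ + 1 - x μ = 1 by ring]
    refine (min_le_right _ _).trans ?_
    rw [ZMod.val_one_eq_one_mod]
    exact Nat.mod_le 1 _
  · rw [shift_apply_of_ne x h, sub_self]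
    exact (min_le_left _ _).trans (by rw [ZMod.val_zero]; exact Nat.zero_le _)

/-- ★ **THE NEIGHBOUR IS A NEAR SITE**: `|x − (x+e_κ)|_T ≤ 1 ≤ L^{j(x)}`. [cite: Balaban1985BackgroundPropagators, (3.40) p.397 («|x − x′| ≦ 1»), bookkeeping] -/
theorem nearS_chartY_shift (x : Site (PV d ℓ i.m i.K hd hL) 0) (κ' : Fin (d + 1)) : NearS i (chartY i x) (chartY i (x.shift κ')) := by
  show torusSupNorm (toKT i).NB ((chartY i x).1 - (chartY i (x.shift κ')).1) ≤ (((ℓ + 1 : ℕ) : ℝ)) ^ levY i (chartY i x)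
  rw [← neg_sub, torusSupNorm_neg (fun μ => one_le_of_mem (chartY i x).2 μ), ← supDist_eq_torusSupNorm i x (x.shift κ')]
  have h1 : (supDist x (x.shift κ') : ℝ) ≤ 1 := by exact_mod_cast supDist_self_shift_le_one x κ'
  have hL1 : (1 : ℝ) ≤ ((ℓ + 1 : ℕ) : ℝ) := by exact_mod_cast Nat.succ_le_succ (Nat.zero_le ℓ)
  exact h1.trans (one_le_pow₀ hL1)

/-- the levels of a site and its neighbour differ by at most one. [cite: Balaban1984PropagatorsII, (2.2) p.224, bookkeeping] -/
theorem levY_chartY_shift_window (x : Site (PV d ℓ i.m i.K hd hL) 0) (κ' : Fin (d + 1)) :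
    levY i (chartY i x) ≤ levY i (chartY i (x.shift κ')) + 1 ∧ levY i (chartY i (x.shift κ')) ≤ levY i (chartY i x) + 1 :=
  levY_window_of_nearS i (nearS_chartY_shift i x κ')

end Lattice

/-! ## §3 The letter's assembled values and its transported pair term -/

section Letter

variable (i : KIdx d ℓ hd hL b₀ b₁) [FiniteDimensional ℝ 𝔸] (b : Module.Basis κ ℝ 𝔸) {B : B9.Backgrounds} (cfg : B.Cfg → CfgY 𝔸 i) (U₁ : B.Cfg)

omit [FiniteDimensional ℝ 𝔸] in
/-- ★ **THE ASSEMBLED BOND VALUE OF `J_μλ`**: `−R(U_μ(x))` applied to the slice of `λ` assembled at the neighbour `x + e_μ`, on bonds of direction `μ`; zero on the others.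
[cite: Balaban1985BackgroundPropagators, (3.3) p.391] -/
theorem assembleK_JcoKH (μ : Fin (d + 1)) (lam : XSK κ i → ℝ) (ν : Fin (d + 1)) (c' : κ) (xb : FBondY i) :
    assembleK b ν c' (JcoKH i b B cfg μ U₁ lam) xb =
      if xb.dir = μ then -R (cfg U₁ μ xb.src) (assembleK b ν c' lam (chartY i (xb.src.shift μ))) else 0 := by
  rw [JcoKH, assembleK_coordOpKH]
  exact Jb_apply i (cfg U₁) μ _ xb

omit [FiniteDimensional ℝ 𝔸] in
/-- off the direction `μ`, `J_μλ` vanishes. [cite: Balaban1985BackgroundPropagators, (3.3) p.391, bookkeeping] -/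
theorem JcoKH_apply_of_ne (μ : Fin (d + 1)) (lam : XSK κ i → ℝ) {xb : FBondY i} (h : xb.dir ≠ μ) (ν : Fin (d + 1)) (a c' : κ) :
    JcoKH i b B cfg μ U₁ lam (xb, ν, a, c') = 0 := by
  rw [JcoKH_apply]
  dsimp only
  rw [Jb_apply, if_neg h, map_zero, Finsupp.zero_apply]

/-- ★ **THE SIZE OF A COORDINATE OF `J_μλ`** (unitary-like links): `|(J_μλ)(b, ν, a, c)| ≤ c_b·‖X⁺‖`, `X⁺` the slice of `λ` assembled at the neighbour of the source.
[cite: Balaban1985BackgroundPropagators, (3.3) p.391 + (3.35) p.396, bookkeeping] -/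
theorem abs_JcoKH_apply_le [NormOneClass 𝔸] (hU : ∀ μ' t, UnitaryLike (cfg U₁ μ' t)) (μ : Fin (d + 1)) (lam : XSK κ i → ℝ) (xb : FBondY i)
    (ν : Fin (d + 1)) (a c' : κ) :
    |JcoKH i b B cfg μ U₁ lam (xb, ν, a, c')| ≤ coordBound39 b * ‖assembleK b ν c' lam (chartY i (xb.src.shift μ))‖ := by
  have hcb : 0 ≤ coordBound39 b := by unfold coordBound39; exact norm_nonneg _
  rw [JcoKH_apply]
  dsimp only
  rw [Jb_apply]
  split_ifs with h
  · calc _ ≤ coordBound39 b * ‖-R (cfg U₁ μ xb.src) (assembleK b ν c' lam (chartY i (xb.src.shift μ)))‖ := abs_repr_le b _ a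
      _ ≤ _ := by rw [norm_neg]; exact mul_le_mul_of_nonneg_left (norm_R_le (hU μ xb.src) _) hcb
  · rw [map_zero, Finsupp.zero_apply, abs_zero]; positivity

omit [NormedAlgebra ℂ 𝔸] [CompleteSpace 𝔸] [FiniteDimensional ℝ 𝔸] in
/-- ★★ **THE ALGEBRA OF THE PAIR TERM**: `−R(u)X⁺ − R(g)(−R(u′)X′⁺) = −R(u)·(X⁺ − R(u⁻¹gu′)X′⁺)`. [cite: Balaban1985BackgroundPropagators, (3.40) p.397 + (3.3) p.391, bookkeeping] -/
theorem jb_pair_identity (u u' g : 𝔸ˣ) (Xp Xp' : 𝔸) :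
    -R u Xp - R g (-R u' Xp') = -R u (Xp - R (u⁻¹ * g * u') Xp') := by
  have e : u * (u⁻¹ * g * u') = g * u' := by group
  rw [R_neg, R_sub, ← B9Eq39Adjoint.R_mul, ← B9Eq39Adjoint.R_mul, e]
  abel

omit [FiniteDimensional ℝ 𝔸] in
/-- ★★ **THE TRANSPORTED PAIR TERM OF `J_μλ` AT A BOND PAIR OF DIRECTION `μ`**: `Δ^{taxiB}_{x,x′}(J_μλ) = −R(U_μ(x))·(X⁺ − R(U_μ(x)⁻¹U(Γ_{x,x′})U_μ(x′))X′⁺)` read in the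
coordinate `a` (`X⁺, X′⁺` the slices of `λ` assembled at `x + e_μ`, `x′ + e_μ`). [cite: Balaban1985BackgroundPropagators, (3.40) p.397 + (3.3) p.391] -/
theorem trDif_JcoKH (μ : Fin (d + 1)) (lam : XSK κ i → ℝ) (x x' : Site (PV d ℓ i.m i.K hd hL) 0) (ν : Fin (d + 1)) (a c' : κ) :
    trDif b (taxiB i B cfg U₁) (⟨x, μ⟩, ν, a, c') (⟨x', μ⟩, ν, a, c') (JcoKH i b B cfg μ U₁ lam) =
      b.repr (-R (cfg U₁ μ x) (assembleK b ν c' lam (chartY i (x.shift μ)) -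
        R ((cfg U₁ μ x)⁻¹ * taxiB i B cfg U₁ ⟨x, μ⟩ ⟨x', μ⟩ * cfg U₁ μ x') (assembleK b ν c' lam (chartY i (x'.shift μ))))) a := by
  rw [trDif_apply]
  dsimp only
  rw [assembleK_JcoKH, assembleK_JcoKH, if_pos rfl, if_pos rfl, jb_pair_identity]

omit [FiniteDimensional ℝ 𝔸] in
/-- off the direction `μ`, the pair term of `J_μλ` vanishes. [cite: Balaban1985BackgroundPropagators, (3.3) p.391, bookkeeping] -/
theorem trDif_JcoKH_of_ne (μ : Fin (d + 1)) (lam : XSK κ i → ℝ) {x x' : FBondY i} (hx : x.dir ≠ μ) (hx' : x'.dir ≠ μ) (ν : Fin (d + 1)) (a c' : κ) :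
    trDif b (taxiB i B cfg U₁) (x, ν, a, c') (x', ν, a, c') (JcoKH i b B cfg μ U₁ lam) = 0 := by
  rw [trDif_apply]
  dsimp only
  rw [assembleK_JcoKH, assembleK_JcoKH, if_neg hx, if_neg hx', R_def, mul_zero, zero_mul, sub_zero, map_zero, Finsupp.zero_apply]

omit [FiniteDimensional ℝ 𝔸] in
/-- the site transporter at the charted shifted points IS the V1 transporter between the shifted points (both `parTaxiV` on base points).
[cite: Balaban1985BackgroundPropagators, (3.40) p.397, dictionary] -/
theorem taxiS_chartY_shift (μ : Fin (d + 1)) (x x' : Site (PV d ℓ i.m i.K hd hL) 0) :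
    taxiS i B cfg U₁ (chartY i (x.shift μ)) (chartY i (x'.shift μ)) = parTaxiV (cfg U₁) (x.shift μ) (x'.shift μ) := by
  have e1 : (boxEquiv i.hN).symm (chartY i (x.shift μ)) = x.shift μ := (boxEquiv i.hN).symm_apply_apply _
  have e2 : (boxEquiv i.hN).symm (chartY i (x'.shift μ)) = x'.shift μ := (boxEquiv i.hN).symm_apply_apply _
  show parTaxiV (cfg U₁) ((boxEquiv i.hN).symm (chartY i (x.shift μ))) ((boxEquiv i.hN).symm (chartY i (x'.shift μ))) = _
  rw [e1, e2]

omit [FiniteDimensional ℝ 𝔸] in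
/-- the bond transporter IS the V1 transporter between the base points. [cite: Balaban1985BackgroundPropagators, (3.40) p.397, dictionary] -/
theorem taxiB_mk (μ : Fin (d + 1)) (x x' : Site (PV d ℓ i.m i.K hd hL) 0) :
    taxiB i B cfg U₁ ⟨x, μ⟩ ⟨x', μ⟩ = parTaxiV (cfg U₁) x x' := rfl

end Letter

/-! ## §4 Two real inequalities of the pair weights -/

section Weights

omit [Fintype κ] in
/-- `((t·c)^s)⁻¹·t ≤ (c^s)⁻¹`-type: for `0 < sd ≤ Lj`, `((sd∕N)^s)⁻¹·(sd∕Lj) ≤ ((Lj∕N)^s)⁻¹` (`= (sd∕Lj)^{1−s} ≤ 1`). [cite: Balaban1984PropagatorsII, (2.51) p.232, bookkeeping] -/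
theorem weight_ratio_le {sd N Lj s : ℝ} (hsd : 0 < sd) (hN : 0 < N) (hLj : 0 < Lj) (hle : sd ≤ Lj) (hs1 : s ≤ 1) :
    ((sd / N) ^ s)⁻¹ * (sd / Lj) ≤ ((Lj / N) ^ s)⁻¹ := by
  have hr0 : 0 < sd / Lj := div_pos hsd hLj
  have hr1 : sd / Lj ≤ 1 := (div_le_one hLj).2 hle
  have hLN : 0 < Lj / N := div_pos hLj hN
  have e1 : sd / N = (Lj / N) * (sd / Lj) := by field_simp
  rw [e1, Real.mul_rpow hLN.le hr0.le, mul_inv, mul_assoc]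
  refine mul_le_of_le_one_right (inv_nonneg.2 (Real.rpow_nonneg hLN.le _)) ?_
  rw [← Real.rpow_neg hr0.le]
  calc (sd / Lj) ^ (-s) * (sd / Lj) = (sd / Lj) ^ (-s) * (sd / Lj) ^ (1 : ℝ) := by rw [Real.rpow_one]
    _ = (sd / Lj) ^ (-s + 1) := by rw [← Real.rpow_add hr0]
    _ ≤ 1 := Real.rpow_le_one hr0.le hr1 (by linarith)

omit [Fintype κ] in
/-- `a ≤ K·c`, `K ≥ 1`, `0 ≤ s ≤ 1` give `(c^s)⁻¹ ≤ K·(a^s)⁻¹`. [cite: Balaban1984PropagatorsII, (2.51) p.232, bookkeeping] -/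
theorem inv_rpow_le_of_le_mul {a c K s : ℝ} (ha : 0 < a) (hc : 0 < c) (hK : 1 ≤ K) (h : a ≤ K * c) (hs0 : 0 ≤ s) (hs1 : s ≤ 1) :
    (c ^ s)⁻¹ ≤ K * (a ^ s)⁻¹ := by
  have hK0 : 0 < K := lt_of_lt_of_le one_pos hK
  have has : 0 < a ^ s := Real.rpow_pos_of_pos ha _
  have hcs : 0 < c ^ s := Real.rpow_pos_of_pos hc _
  have h1 : a ^ s ≤ K * c ^ s :=
    calc a ^ s ≤ (K * c) ^ s := Real.rpow_le_rpow ha.le h hs0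
      _ = K ^ s * c ^ s := Real.mul_rpow hK0.le hc.le
      _ ≤ K * c ^ s := by
          refine mul_le_mul_of_nonneg_right ?_ hcs.le
          calc K ^ s ≤ K ^ (1 : ℝ) := Real.rpow_le_rpow_of_exponent_le hK hs1
            _ = K := Real.rpow_one K
  rw [← div_eq_mul_inv, le_div_iff₀ has]
  calc (c ^ s)⁻¹ * a ^ s ≤ (c ^ s)⁻¹ * (K * c ^ s) := mul_le_mul_of_nonneg_left h1 (inv_nonneg.2 hcs.le)
    _ = K := by field_simp

end Weights


end Literature.MathematicalPhysics.QuantumFieldTheory.Balaban1983to89.B9GradLetterTransportedDict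

end
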